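import Summits.NavierStokesRegularity.FunctionalMining.Candidates
import Literature.Analysis.FluidPDE.TorusStrainVorticityIsometry
import HarnessLib

/-!
# Functional mining: the static stretching bound with Hölder's constant `2/√3` (K1-Q1 window)

Search for candidate a priori estimates; no regularity claim.

Cell `pub-nsfunc` (host summit NavierStokesRegularity, topic `FunctionalMining`), prove seat; the
dictionary's typed target `StretchingSupHolder` (`Candidates.lean`, K0 rows `E.q=2|T_C|C3b`, NOGO N2):

  `∫⟪(v·∇)v, Δv⟫ ≤ (2/√3) · M · ℰ(v)` for smooth divergence-free `v` on `T³` with `|ω|² ≤ M²`.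

The tree's Doering–Gibbon discharge (`FluidPDE/ExtremeGrowthVorticityControlProofs`,
`FluidPDE/TorusEnstrophyDissipationLowerBound`) gives the constant `2` from the pointwise bound
`ωᵀSω ≤ |ω|²|S| ≤ M|∇v|²`. Hölder's constant comes from two sharper steps:
* **pointwise** (`HolderStretching.quadForm_sq_le_two_thirds`): for a TRACE-FREE `3 × 3` array
  `S`, `(ωᵀSω)² ≤ (2/3)|S|_F²|ω|⁴` — i.e. `λ_max(S) ≤ √(2/3)|S|_F` — proved WITHOUT eigenvalues by
  Cauchy–Schwarz in matrix space against `T = (3/2)ω⊗ω − ½|ω|²I` (`⟨S,T⟩ = (3/2)ωᵀSω`,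
  `|T|² = (3/2)|ω|⁴`); hence (`cubeTrace_sub_stretchCubic_le_holder`) for trace-free `G`,
  `tr G³ − tr GGᵀG = ωᵀSω ≤ (M/√3)(|S|_F² + ½|ω|²)` when `|ω|² ≤ M²` (AM–GM in the form that
  integrates exactly);
* **integrated** (`stretchingSupHolder_holds`): `‖S‖₂² = ℰ` and `‖ω‖₂² = 2ℰ`
  (`FluidPDE/TorusStrainVorticityIsometry`), Betchov `∫tr(∇v)³ = 0` and the orthogonality form
  of the production (`Torus.integral_inner_laplacian_convect_self_eq_neg`) give
  `∫⟪(v·∇)v, Δv⟫ = ∫ωᵀSω ≤ (M/√3)(ℰ + ℰ) = (2/√3)Mℰ`.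

Consequences: `stretchingSupHolder_holds : StretchingSupHolder`, the dynamic form
`enstrophyRateSupBound_holder : EnstrophyRateSupBound (2/√3)` (`dℰ/dt ≤ (2/√3)‖ω‖_∞ℰ` along every
classical solution, improving the tree's Doering–Gibbon constant `2`), so the K1-Q1 window of the
dictionary is `(0, 2/√3]`. No definitions.
-/

noncomputable section

open Set MeasureTheory Finset
open scoped InnerProductSpace RealInnerProductSpace

namespace Summit.NavierStokesRegularity.FunctionalMining

open Literature.Analysis.FunctionSpaces Literature.Analysis.FluidPDE

/-! ## Pointwise algebra on `3 × 3` arrays: the Hölder constant -/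

namespace HolderStretching

/-- **`λ_max(S)² ≤ (2/3)|S|_F²` in quadratic-form form**: for a trace-free `3 × 3` array `S` and
every `w`, `(wᵀSw)² ≤ (2/3) (∑ᵢⱼ Sᵢⱼ²) (|w|²)²`. Cauchy–Schwarz in `ℝ^{3×3}` between `S` and
`T = (3/2) w⊗w − ½|w|² I`: `⟨S, T⟩ = (3/2) wᵀSw` (trace-free), `|T|² = (3/2)|w|⁴`. [folklore] -/
theorem quadForm_sq_le_two_thirds (S : Fin 3 → Fin 3 → ℝ) (htr : ∑ i, S i i = 0)
    (w : Fin 3 → ℝ) :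
    (∑ i, ∑ j, w i * S i j * w j) ^ 2 ≤ 2 / 3 * (∑ i, ∑ j, S i j ^ 2) * (∑ i, w i ^ 2) ^ 2 := by
  set n2 : ℝ := ∑ i, w i ^ 2 with hn2
  set T : Fin 3 × Fin 3 → ℝ := fun p =>
    3 / 2 * (w p.1 * w p.2) - if p.1 = p.2 then n2 / 2 else 0 with hT
  have hCS := Finset.sum_mul_sq_le_sq_mul_sq (univ : Finset (Fin 3 × Fin 3))
    (fun p => S p.1 p.2) T
  have h1 : ∑ p : Fin 3 × Fin 3, S p.1 p.2 * T p = 3 / 2 * ∑ i, ∑ j, w i * S i j * w j := by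
    have htr' : S 0 0 + S 1 1 + S 2 2 = 0 := by simpa [Fin.sum_univ_three] using htr
    rw [Fintype.sum_prod_type]
    simp only [hT, hn2, Fin.sum_univ_three, Fin.isValue]
    simp
    nlinarith [htr']
  have h2 : ∑ p : Fin 3 × Fin 3, (S p.1 p.2) ^ 2 = ∑ i, ∑ j, S i j ^ 2 := by
    rw [Fintype.sum_prod_type]
  have h3 : ∑ p : Fin 3 × Fin 3, T p ^ 2 = 3 / 2 * n2 ^ 2 := by
    rw [Fintype.sum_prod_type]
    simp only [hT, hn2, Fin.sum_univ_three, Fin.isValue]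
    simp
    ring
  rw [h1, h2, h3] at hCS
  nlinarith [hCS]

/-- **The pointwise Hölder stretching bound.** For a trace-free `3 × 3` array `G` (`Gᵢⱼ = ∂ⱼuᵢ`),
its vorticity vector `ω` with `|ω|² ≤ M²` (`M ≥ 0`) and symmetric part `S`:
`tr G³ − tr GGᵀG (= ωᵀSω) ≤ (M/√3) · (|S|_F² + ½|ω|²)` — from `(ωᵀSω)² ≤ (2/3)|S|²|ω|²·M²` and
`(|S|² + ½|ω|²)² ≥ 2|S|²|ω|²`. [folklore] -/
theorem cubeTrace_sub_stretchCubic_le_holder (G : Fin 3 → Fin 3 → ℝ) {M : ℝ} (hM : 0 ≤ M)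
    (htr : ∑ i, G i i = 0) (w : Fin 3 → ℝ)
    (hw : w = ![G 2 1 - G 1 2, G 0 2 - G 2 0, G 1 0 - G 0 1]) (hω : ∑ i, w i ^ 2 ≤ M ^ 2) :
    (∑ i, ∑ j, ∑ k, G i j * G j k * G k i) - (∑ i, ∑ j, ∑ m, G i m * G j m * G j i) ≤
      M / Real.sqrt 3 * ((∑ i, ∑ j, ((G i j + G j i) / 2) ^ 2) + 2⁻¹ * ∑ i, w i ^ 2) := by
  set Q : ℝ := ∑ i, ∑ j, w i * ((G i j + G j i) / 2) * w j with hQ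
  set x : ℝ := ∑ i, ∑ j, ((G i j + G j i) / 2) ^ 2 with hx
  set wsq : ℝ := ∑ i, w i ^ 2 with hwsq
  have hid : (∑ i, ∑ j, ∑ k, G i j * G j k * G k i) - (∑ i, ∑ j, ∑ m, G i m * G j m * G j i) =
      Q := by
    rw [DoeringGibbon1995.cubeTrace_sub_stretchCubic G w hw, htr, mul_zero, sub_zero]
  have htrS : ∑ i, (G i i + G i i) / 2 = 0 := by
    rw [show (∑ i, (G i i + G i i) / 2) = ∑ i, G i i from
      Finset.sum_congr rfl fun i _ => by ring, htr]
  have hx0 : 0 ≤ x := Finset.sum_nonneg fun i _ => Finset.sum_nonneg fun j _ => sq_nonneg _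
  have hw0 : 0 ≤ wsq := Finset.sum_nonneg fun i _ => sq_nonneg _
  have h3 : 0 < Real.sqrt 3 := Real.sqrt_pos.2 (by norm_num)
  have hsq3 : Real.sqrt 3 ^ 2 = 3 := Real.sq_sqrt (by norm_num)
  -- `Q² ≤ (2/3) x wsq²`, hence `Q² ≤ (2/3) x wsq M²`
  have hQ2 : Q ^ 2 ≤ 2 / 3 * x * wsq ^ 2 :=
    quadForm_sq_le_two_thirds (fun i j => (G i j + G j i) / 2) htrS w
  have hQ2' : Q ^ 2 ≤ 2 / 3 * x * wsq * M ^ 2 := by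
    calc Q ^ 2 ≤ 2 / 3 * x * wsq ^ 2 := hQ2
      _ = 2 / 3 * x * wsq * wsq := by ring
      _ ≤ 2 / 3 * x * wsq * M ^ 2 := mul_le_mul_of_nonneg_left hω (by positivity)
  -- the right side `R = (M/√3)(x + wsq/2)` has `R² ≥ (2/3) x wsq M²`
  set R : ℝ := M / Real.sqrt 3 * (x + 2⁻¹ * wsq) with hR
  have hR0 : 0 ≤ R := by positivity
  have hR2 : 2 / 3 * x * wsq * M ^ 2 ≤ R ^ 2 := by
    have hRsq : R ^ 2 = M ^ 2 / 3 * (x + 2⁻¹ * wsq) ^ 2 := by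
      rw [hR, mul_pow, div_pow, hsq3]
    rw [hRsq]
    nlinarith [sq_nonneg (x - 2⁻¹ * wsq), sq_nonneg M, hx0, hw0]
  have hQle : Q ≤ R := (abs_le_of_sq_le_sq' (hQ2'.trans hR2) hR0).2
  rw [hid]
  exact hQle

end HolderStretching

/-! ## The pointwise bound on the torus and the integrated Hölder bound -/

variable {d : Type*} [Fintype d] [DecidableEq d]

/-- **Pointwise, on the torus**: for a smooth divergence-free `v` on `T³` with
`torusVorticitySqAt v x ≤ M²`, the Betchov-corrected stretching density at `x` is at most
`(M/√3) (|S(x)|_F² + ½|ω(x)|²)` (coordinates as in the tree's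
`sum_partialDeriv_cube_sub_stretch_le`). [folklore] -/
theorem sum_partialDeriv_cube_sub_stretch_le_holder (hd : Fintype.card d = 3)
    {v : UnitAddTorus d → EuclideanSpace ℝ d} (hv : Torus.IsSmooth v) (hdiv : Torus.IsDivFree v)
    {M : ℝ} (hM : 0 ≤ M) (x : UnitAddTorus d) (hω : torusVorticitySqAt v x ≤ M ^ 2) :
    (∑ i, ∑ j, ∑ k, Torus.partialDeriv j v x i * Torus.partialDeriv k v x j *
        Torus.partialDeriv i v x k) -
      (∑ m, ∑ i, Torus.partialDeriv m v x i *
        ⟪Torus.partialDeriv m v x, Torus.partialDeriv i v x⟫_ℝ) ≤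
      M / Real.sqrt 3 *
        ((∑ i, ∑ j, ((Torus.partialDeriv j v x i + Torus.partialDeriv i v x j) / 2) ^ 2) +
          2⁻¹ * torusVorticitySqAt v x) := by
  set e : d ≃ Fin 3 := Fintype.equivFinOfCardEq hd with he
  set R : d → EuclideanSpace ℝ d := fun m => Torus.partialDeriv m v x with hR
  set G : Fin 3 → Fin 3 → ℝ := fun a b => R (e.symm b) (e.symm a) with hG
  have hre : ∀ F : d → ℝ, ∑ i, F i = ∑ a : Fin 3, F (e.symm a) := fun F =>
    Fintype.sum_equiv e _ _ fun i => by simp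
  -- (i) the cubic trace
  have hB : ∑ i, ∑ j, ∑ k, R j i * R k j * R i k = ∑ a, ∑ b, ∑ c, G a b * G b c * G c a := by
    simp only [hG]
    simp_rw [hre]
  -- (ii) the stretching cubic
  have hC : ∑ m, ∑ i, R m i * ⟪R m, R i⟫_ℝ = ∑ a, ∑ b, ∑ c, G a c * G b c * G b a := by
    have h1 : ∑ m, ∑ i, R m i * ⟪R m, R i⟫_ℝ = ∑ i, ∑ j, ∑ m, R m i * R m j * R i j := by
      have hinner : ∀ m i, R m i * ⟪R m, R i⟫_ℝ = ∑ j, R m i * R m j * R i j := by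
        intro m i
        rw [show ⟪R m, R i⟫_ℝ = ∑ j, R m j * R i j from by simp [PiLp.inner_apply, mul_comm],
          Finset.mul_sum]
        exact Finset.sum_congr rfl fun j _ => by ring
      simp_rw [hinner]
      rw [Finset.sum_comm]
      exact Finset.sum_congr rfl fun i _ => Finset.sum_comm
    rw [h1]
    simp only [hG]
    simp_rw [hre]
  -- (iii) the trace is the divergence
  have htr : ∑ a, G a a = 0 := by
    have h1 : ∑ a, G a a = ∑ m, R m m := by
      simp only [hG]; rw [hre]
    rw [h1, hR]
    have h2 := Torus.divergence_eq_sum_partialDeriv_apply (hv.isContDiff (by simp)) x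
    rw [← h2]
    exact hdiv x
  -- (iv) the vorticity
  set w : Fin 3 → ℝ := ![G 2 1 - G 1 2, G 0 2 - G 2 0, G 1 0 - G 0 1] with hw
  have hvort : ∑ a, w a ^ 2 = torusVorticitySqAt v x := by
    rw [DoeringGibbon1995.sum_vort_sq G w hw, torusVorticitySqAt]
    congr 1
    simp only [hG, hR]
    simp_rw [hre]
    rw [Finset.sum_comm]
  -- (v) the strain norm
  have hstrain : ∑ a, ∑ b, ((G a b + G b a) / 2) ^ 2 =
      ∑ i, ∑ j, ((R j i + R i j) / 2) ^ 2 := by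
    simp only [hG]
    simp_rw [hre]
  have key := HolderStretching.cubeTrace_sub_stretchCubic_le_holder G hM htr w hw (hvort ▸ hω)
  rw [hB, hC, ← hstrain, ← hvort]
  exact key

/-- **The static stretching bound with Hölder's constant `2/√3` HOLDS** (`StretchingSupHolder`,
dictionary K1-Q1 window `(0, 2/√3]`): for every smooth divergence-free `v` on `T³` with
`|ω(x)|² ≤ M²` pointwise, `∫⟪(v·∇)v, Δv⟫ ≤ (2/√3) M ℰ(v)`. Proof: orthogonality form + Betchov,
the pointwise Hölder bound, `‖S‖₂² = ℰ`, `‖ω‖₂² = 2ℰ`. [folklore] -/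
theorem stretchingSupHolder_holds : StretchingSupHolder (d := d) := by
  intro hd v hv hdiv M hM hω
  have hD : ∀ m, Torus.IsSmooth (Torus.partialDeriv m v) := fun m => hv.partialDeriv m
  have hDc : ∀ m j, Torus.IsSmooth (fun y => Torus.partialDeriv m v y j) :=
    fun m j => (hD m).apply j
  set B : UnitAddTorus d → ℝ := fun x => ∑ i, ∑ j, ∑ k, Torus.partialDeriv j v x i *
    Torus.partialDeriv k v x j * Torus.partialDeriv i v x k with hB_def
  set C : UnitAddTorus d → ℝ := fun x => ∑ m, ∑ i, Torus.partialDeriv m v x i *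
    ⟪Torus.partialDeriv m v x, Torus.partialDeriv i v x⟫_ℝ with hC_def
  set X : UnitAddTorus d → ℝ := fun x =>
    ∑ i, ∑ j, ((Torus.partialDeriv j v x i + Torus.partialDeriv i v x j) / 2) ^ 2 with hX_def
  have hBs : Torus.IsSmooth B := by
    have h : ∀ i j k, Torus.IsSmooth (fun x => Torus.partialDeriv j v x i *
        Torus.partialDeriv k v x j * Torus.partialDeriv i v x k) :=
      fun i j k => ((hDc j i).mul (hDc k j)).mul (hDc i k)
    unfold Torus.IsSmooth at h ⊢
    exact ContDiff.sum fun i _ => ContDiff.sum fun j _ => ContDiff.sum fun k _ => h i j k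
  have hCs : Torus.IsSmooth C := by
    have h : ∀ m i, Torus.IsSmooth (fun x => Torus.partialDeriv m v x i *
        ⟪Torus.partialDeriv m v x, Torus.partialDeriv i v x⟫_ℝ) :=
      fun m i => (hDc m i).mul ((hD m).inner (hD i))
    unfold Torus.IsSmooth at h ⊢
    exact ContDiff.sum fun m _ => ContDiff.sum fun i _ => h m i
  have hXs : Torus.IsSmooth X := by
    have h : ∀ i j, Torus.IsSmooth (fun x =>
        ((Torus.partialDeriv j v x i + Torus.partialDeriv i v x j) / 2) ^ 2) :=
      fun i j => (((hDc j i).add (hDc i j)).div_const 2).pow 2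
    unfold Torus.IsSmooth at h ⊢
    exact ContDiff.sum fun i _ => ContDiff.sum fun j _ => h i j
  have hVs : Torus.IsSmooth (torusVorticitySqAt v) := by
    have h : ∀ i j, Torus.IsSmooth (fun x =>
        ((Torus.partialDeriv i v x) j - (Torus.partialDeriv j v x) i) ^ 2) :=
      fun i j => ((hDc i j).sub (hDc j i)).pow 2
    have hsum : Torus.IsSmooth (fun x => ∑ i, ∑ j,
        ((Torus.partialDeriv i v x) j - (Torus.partialDeriv j v x) i) ^ 2) := by
      unfold Torus.IsSmooth at h ⊢
      exact ContDiff.sum fun i _ => ContDiff.sum fun j _ => h i j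
    have : torusVorticitySqAt v = fun x => 2⁻¹ * ∑ i, ∑ j,
        ((Torus.partialDeriv i v x) j - (Torus.partialDeriv j v x) i) ^ 2 := rfl
    rw [this]
    exact hsum.smul 2⁻¹
  -- the production in orthogonality form, Betchov
  have hcomm : enstrophyProduction v = ∫ x, ⟪Torus.laplacian v x, Torus.convect v v x⟫_ℝ := by
    unfold enstrophyProduction
    exact congrArg (fun f : UnitAddTorus d → ℝ => ∫ x, f x)
      (funext fun x => real_inner_comm (Torus.laplacian v x) (Torus.convect v v x))
  have horth : ∫ x, ⟪Torus.laplacian v x, Torus.convect v v x⟫_ℝ = -∫ x, C x :=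
    Torus.integral_inner_laplacian_convect_self_eq_neg hv hdiv
  have hBet : ∫ x, B x = 0 := integral_sum_partialDeriv_cube_eq_zero hv hdiv
  have hdiff : -∫ x, C x = ∫ x, (B x - C x) := by
    rw [integral_sub hBs.integrable hCs.integrable, hBet, zero_sub]
  -- the pointwise Hölder bound and its integral
  have hpt : ∀ x, B x - C x ≤ M / Real.sqrt 3 * (X x + 2⁻¹ * torusVorticitySqAt v x) := fun x =>
    sum_partialDeriv_cube_sub_stretch_le_holder hd hv hdiv hM x (hω x)
  have hGi : Integrable (fun x => M / Real.sqrt 3 * (X x + 2⁻¹ * torusVorticitySqAt v x)) :=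
    (hXs.integrable.add (hVs.integrable.const_mul _)).const_mul _
  have hmono : ∫ x, (B x - C x) ≤ ∫ x, M / Real.sqrt 3 * (X x + 2⁻¹ * torusVorticitySqAt v x) :=
    integral_mono (hBs.integrable.sub hCs.integrable) hGi hpt
  have hval : ∫ x, M / Real.sqrt 3 * (X x + 2⁻¹ * torusVorticitySqAt v x) =
      2 / Real.sqrt 3 * M * torusEnstrophy v := by
    rw [integral_const_mul, integral_add hXs.integrable (hVs.integrable.const_mul _),
      integral_const_mul, integral_strainNormSq_eq_torusEnstrophy hv hdiv,
      integral_torusVorticitySqAt_eq_two_mul_torusEnstrophy hv hdiv]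
    ring
  rw [hcomm, horth, hdiff]
  exact hmono.trans_eq hval

/-- **Dynamic form: `dℰ/dt ≤ (2/√3) ‖ω‖_∞ ℰ`** along every classical solution of unforced
Navier–Stokes/Euler on `T³` (the dictionary's `EnstrophyRateSupBound (2/√3)`, by its proved
reduction static ⇒ dynamic); improves the constant `2` of the tree's Doering–Gibbon discharge.
[folklore] -/
theorem enstrophyRateSupBound_holder : EnstrophyRateSupBound (d := d) (2 / Real.sqrt 3) :=
  enstrophyRateSupBound_of_stretchingSupBound stretchingSupHolder_holds

end Summit.NavierStokesRegularity.FunctionalMining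

end
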